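import Mathlib
import HarnessLib

/-!
# Abelian theorem: power-log sublevel volumes give power-log Laplace asymptotics

Topic `Literature/Analysis/Asymptotics`. Everything in this file is PROVED; no definitions, no
named facts.

Let `(X, μ)` be a finite measure space, `S : X → [0, ∞)` measurable, `V(t) = μ{S ≤ t}` the
sublevel volume and `Z(β) = ∫ e^{-β S} dμ` the Laplace integral. If

  `V(t) ∼ c · t^λ · (log 1/t)^m`  as `t → 0⁺`   (`λ ≥ 0` real, `m ∈ ℕ`, `c ∈ ℝ`),

then

  `Z(β) ∼ c Γ(λ+1) · β^{-λ} · (log β)^m`  as `β → +∞`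

(`tendsto_laplace_mul_rpow_div_log_pow`). This is the "Abelian" passage from the volume function
(Gelfand–Leray / state-density side) to the Laplace integral in the asymptotic theory of Laplace
integrals with analytic phase, in leading order and for measures: the formula
`∫₀^∞ e^{-τt} t^α (ln t)^k θ(t) dt ≈ (d/dα)^k Γ(α+1) τ^{-α-1}` of Arnold–Gusein-Zade–Varchenko II
§7.2.4 (after Thm. 7.4; Corollary of Thm. 7.6), the step (3) ⟹ (1) of Watanabe 2009 Thm. 7.1, the
Laplace-transform step of Lin arXiv:1003.5338 Thm. 2.9; and the `t → 0⁺ / β → ∞` dual, with a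
logarithmic slowly varying factor, of the Abelian half of Karamata's theorem (Feller II XIII.5
Thm. 2; the tree's `KaramataAbelianLaplace.lean` treats index `1` at `δ ↓ 0`).
Proof: `Z(β) = ∫₀^∞ e^{-u} V(u/β) du` (Tonelli, `e^{-βs} = ∫_{u ≥ βs} e^{-u} du`), then dominated
convergence for `e^{-u} V(u/β) β^λ/(log β)^m → c u^λ e^{-u}` under the bound
`K (u^{λ-1/2} + u^λ) e^{-u}` (`V(t) ≤ (|c|+1) t^λ (log 1/t)^m` for small `t`,
`((log β - log u)/log β)^m ≤ (1+2m)^m u^{-1/2}` for `u ≤ 1`, `≤ 1` for `1 ≤ u ≤ β`, and `V ≤ μ(X)`,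
`β^λ ≤ (u/t₀)^λ` for `u ≥ β t₀`), and `∫₀^∞ u^λ e^{-u} du = Γ(λ+1)`.

## References

* V. I. Arnold, S. M. Gusein-Zade, A. N. Varchenko, *Singularities of Differentiable Maps II*,
  Birkhäuser (2012), Part II §7.2.4, §7.3.3 Thm. 7.6 and Corollary. [ArnoldGuseinzadeVarchenko2012]
* S. Watanabe, *Algebraic Geometry and Statistical Learning Theory* (2009), Thm. 7.1. [WatanabeSumio2009]
* W. Feller, *An Introduction to Probability Theory II* (1971), XIII.5 Thm. 2. [Feller1971]
-/

noncomputable section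

open MeasureTheory Filter Set
open scoped Topology ENNReal

namespace Literature.Analysis.Asymptotics

namespace LaplacePowerLog

variable {X : Type*} [MeasurableSpace X] {μ : Measure X} {S : X → ℝ}

/-! ### Step 1: `Z(β) = ∫₀^∞ e^{-u} μ{S ≤ u/β} du` -/

/-- `∫_{u ≥ a} e^{-u} du = e^{-a}` as a Lebesgue integral over `(0,∞) ∩ [a,∞)` for `a ≥ 0`.
[folklore] -/
theorem lintegral_Ioi_indicator_exp_neg {a : ℝ} (ha : 0 ≤ a) :
    ∫⁻ u in Ioi (0 : ℝ), (Ici a).indicator (fun u => ENNReal.ofReal (Real.exp (-u))) u =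
      ENNReal.ofReal (Real.exp (-a)) := by
  rw [lintegral_indicator measurableSet_Ici, Measure.restrict_restrict measurableSet_Ici]
  have hset : (Ici a ∩ Ioi (0 : ℝ) : Set ℝ) =ᵐ[volume] (Ioi a : Set ℝ) := by
    rcases ha.eq_or_lt with rfl | ha'
    · rw [inter_eq_right.2 Ioi_subset_Ici_self]
    · rw [inter_eq_left.2 (Ici_subset_Ioi.2 ha')]
      exact Ioi_ae_eq_Ici.symm
  rw [Measure.restrict_congr_set hset]
  have hint : IntegrableOn (fun u => Real.exp (-u)) (Ioi a) := integrableOn_exp_neg_Ioi a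
  rw [← ofReal_integral_eq_lintegral_ofReal hint
    (ae_of_all _ fun u => (Real.exp_pos _).le), integral_exp_neg_Ioi]

/-- **Tonelli form of the Laplace integral**: for measurable `S ≥ 0` and `β > 0`,
`∫⁻ e^{-βS} dμ = ∫₀^∞ e^{-u} μ{S ≤ u/β} du`. [folklore] -/
theorem lintegral_exp_neg_mul_eq [SFinite μ] (hS : Measurable S) (hS0 : ∀ x, 0 ≤ S x) {β : ℝ}
    (hβ : 0 < β) :
    ∫⁻ x, ENNReal.ofReal (Real.exp (-(β * S x))) ∂μ =
      ∫⁻ u in Ioi (0 : ℝ), ENNReal.ofReal (Real.exp (-u)) * μ {x | S x ≤ u / β} := by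
  -- `e^{-β S x} = ∫_{u ≥ β S x} e^{-u} du`
  have h1 : ∀ x, ENNReal.ofReal (Real.exp (-(β * S x))) =
      ∫⁻ u in Ioi (0 : ℝ), (Ici (β * S x)).indicator (fun u => ENNReal.ofReal (Real.exp (-u))) u :=
    fun x => (lintegral_Ioi_indicator_exp_neg (mul_nonneg hβ.le (hS0 x))).symm
  simp_rw [h1]
  -- swap the integrals
  have hF : Measurable (Function.uncurry fun (x : X) (u : ℝ) =>
      (Ici (β * S x)).indicator (fun u => ENNReal.ofReal (Real.exp (-u))) u) := by
    have : (Function.uncurry fun (x : X) (u : ℝ) =>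
        (Ici (β * S x)).indicator (fun u => ENNReal.ofReal (Real.exp (-u))) u) =
        {p : X × ℝ | β * S p.1 ≤ p.2}.indicator fun p => ENNReal.ofReal (Real.exp (-p.2)) := by
      funext p
      simp only [Function.uncurry, indicator, mem_Ici, mem_setOf_eq]
    rw [this]
    refine Measurable.indicator ?_ (measurableSet_le ((hS.comp measurable_fst).const_mul β)
      measurable_snd)
    exact ENNReal.measurable_ofReal.comp (measurable_snd.neg.exp)
  rw [lintegral_lintegral_swap (hF.aemeasurable)]
  refine setLIntegral_congr_fun measurableSet_Ioi fun u hu => ?_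
  -- inner integral: `e^{-u} μ{β S ≤ u}`
  have hind : ∀ x, (Ici (β * S x)).indicator (fun u => ENNReal.ofReal (Real.exp (-u))) u =
      {x | S x ≤ u / β}.indicator (fun _ => ENNReal.ofReal (Real.exp (-u))) x := by
    intro x
    by_cases hx : S x ≤ u / β
    · have : u ∈ Ici (β * S x) := by
        rw [mem_Ici]; rwa [le_div_iff₀ hβ, mul_comm] at hx
      rw [indicator_of_mem this, indicator_of_mem (show x ∈ {x | S x ≤ u / β} from hx)]
    · have : u ∉ Ici (β * S x) := by
        rw [mem_Ici, not_le]; rw [not_le, div_lt_iff₀ hβ, mul_comm] at hx; exact hx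
      rw [indicator_of_notMem this, indicator_of_notMem (show x ∉ {x | S x ≤ u / β} from hx)]
  simp_rw [hind]
  have hm : MeasurableSet {x | S x ≤ u / β} := hS measurableSet_Iic
  rw [lintegral_indicator hm, setLIntegral_const]


/-- Real-valued form of `lintegral_exp_neg_mul_eq` on a finite measure space:
`∫ e^{-βS} dμ = ∫₀^∞ e^{-u} (μ{S ≤ u/β}).toReal du`. [folklore] -/
theorem integral_exp_neg_mul_eq [IsFiniteMeasure μ] (hS : Measurable S) (hS0 : ∀ x, 0 ≤ S x)
    {β : ℝ} (hβ : 0 < β) :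
    ∫ x, Real.exp (-(β * S x)) ∂μ =
      ∫ u in Ioi (0 : ℝ), Real.exp (-u) * (μ {x | S x ≤ u / β}).toReal := by
  have hL := lintegral_exp_neg_mul_eq (μ := μ) hS hS0 hβ
  have hint : Integrable (fun x => Real.exp (-(β * S x))) μ := by
    refine Integrable.of_bound (C := 1) ((measurable_const.mul hS).neg.exp.aestronglyMeasurable)
      (ae_of_all _ fun x => ?_)
    rw [Real.norm_eq_abs, abs_of_nonneg (Real.exp_pos _).le, Real.exp_le_one_iff]
    exact neg_nonpos.2 (mul_nonneg hβ.le (hS0 x))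
  rw [integral_eq_lintegral_of_nonneg_ae (ae_of_all _ fun x => (Real.exp_pos _).le)
    hint.aestronglyMeasurable, hL]
  have hmeasV : Measurable fun u : ℝ => (μ {x | S x ≤ u / β}).toReal := by
    refine Monotone.measurable fun u v huv => ?_
    exact ENNReal.toReal_mono (measure_ne_top _ _)
      (measure_mono fun x (hx : S x ≤ u / β) => hx.trans (div_le_div_of_nonneg_right huv hβ.le))
  have hnn : 0 ≤ᵐ[volume.restrict (Ioi (0 : ℝ))]
      fun u => Real.exp (-u) * (μ {x | S x ≤ u / β}).toReal :=
    ae_of_all _ fun u => mul_nonneg (Real.exp_pos _).le ENNReal.toReal_nonneg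
  rw [integral_eq_lintegral_of_nonneg_ae hnn
    ((measurable_id.neg.exp.mul hmeasV).aestronglyMeasurable)]
  congr 1
  refine setLIntegral_congr_fun measurableSet_Ioi fun u _ => ?_
  rw [ENNReal.ofReal_mul (Real.exp_pos _).le, ENNReal.ofReal_toReal (measure_ne_top _ _)]

/-! ### Step 2: elementary bounds -/

/-- For `0 < u ≤ 1`, `1 ≤ L`: `((L - log u)/L)^m ≤ (1 + 2m)^m u^{-1/2}`
(from `log(1/u) ≤ u^{-ε}/ε`, `ε = 1/(2m)`, when `m ≥ 1`; trivially when `m = 0`). [folklore] -/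
theorem div_log_pow_le (m : ℕ) {u L : ℝ} (hu : 0 < u) (hu1 : u ≤ 1) (hL : 1 ≤ L) :
    ((L - Real.log u) / L) ^ m ≤ (1 + 2 * m : ℝ) ^ m * u ^ (-(1 / 2 : ℝ)) := by
  rcases Nat.eq_zero_or_pos m with rfl | hm
  · simp only [pow_zero, CharP.cast_eq_zero, mul_zero, add_zero, one_mul]
    exact Real.one_le_rpow_of_pos_of_le_one_of_nonpos hu hu1 (by norm_num)
  set ε : ℝ := 1 / (2 * m) with hε
  have hm0 : (0 : ℝ) < 2 * m := by positivity
  have hε0 : 0 < ε := one_div_pos.2 hm0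
  -- `-log u ≤ u^{-ε}/ε`
  have h1 : -Real.log u ≤ u ^ (-ε) / ε := by
    have h := Real.log_le_rpow_div (inv_nonneg.2 hu.le) hε0
    rwa [Real.log_inv, Real.inv_rpow hu.le, ← Real.rpow_neg hu.le] at h
  -- `1 ≤ u^{-ε}`
  have h2 : 1 ≤ u ^ (-ε) :=
    Real.one_le_rpow_of_pos_of_le_one_of_nonpos hu hu1 (neg_nonpos.2 hε0.le)
  have hL0 : 0 < L := one_pos.trans_le hL
  have hratio : (L - Real.log u) / L ≤ (1 + 2 * m) * u ^ (-ε) := by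
    rw [div_le_iff₀ hL0]
    have h3 : -Real.log u ≤ 2 * m * u ^ (-ε) := by
      calc -Real.log u ≤ u ^ (-ε) / ε := h1
        _ = 2 * m * u ^ (-ε) := by rw [hε]; field_simp
    have h4 : 2 * m * u ^ (-ε) ≤ 2 * m * u ^ (-ε) * L :=
      le_mul_of_one_le_right (by positivity) hL
    nlinarith [mul_nonneg (sub_nonneg.2 h2) hL0.le]
  have hratio0 : 0 ≤ (L - Real.log u) / L :=
    div_nonneg (by linarith [Real.log_nonpos hu.le hu1]) hL0.le
  calc ((L - Real.log u) / L) ^ m ≤ ((1 + 2 * m) * u ^ (-ε)) ^ m :=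
        pow_le_pow_left₀ hratio0 hratio m
    _ = (1 + 2 * m : ℝ) ^ m * u ^ (-(1 / 2 : ℝ)) := by
        rw [mul_pow, ← Real.rpow_natCast (u ^ (-ε)) m, ← Real.rpow_mul hu.le]
        congr 2
        rw [hε]; field_simp

/-- For `1 ≤ u`, `log u ≤ L`, `0 < L`: `0 ≤ (L - log u)/L ≤ 1`, hence its `m`-th power is `≤ 1`.
[folklore] -/
theorem div_log_pow_le_one (m : ℕ) {u L : ℝ} (hu1 : 1 ≤ u) (huL : Real.log u ≤ L) (hL : 0 < L) :
    ((L - Real.log u) / L) ^ m ≤ 1 := by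
  have h0 : 0 ≤ (L - Real.log u) / L := div_nonneg (sub_nonneg.2 huL) hL.le
  have h1 : (L - Real.log u) / L ≤ 1 := by
    rw [div_le_one hL]; linarith [Real.log_nonneg hu1]
  exact pow_le_one₀ h0 h1

/-- The dominating function `K (u^{λ-1/2} + u^λ) e^{-u}` is integrable on `(0,∞)` for `λ ≥ 0`.
[folklore] -/
theorem integrableOn_bound {lam : ℝ} (hlam : 0 ≤ lam) (K : ℝ) :
    IntegrableOn (fun u : ℝ => K * (u ^ (lam - 1 / 2) + u ^ lam) * Real.exp (-u)) (Ioi 0) := by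
  have h1 := Real.GammaIntegral_convergent (s := lam + 1 / 2) (by linarith)
  have h2 := Real.GammaIntegral_convergent (s := lam + 1) (by linarith)
  have h3 : IntegrableOn (fun u : ℝ => K * (Real.exp (-u) * u ^ (lam + 1 / 2 - 1) +
      Real.exp (-u) * u ^ (lam + 1 - 1))) (Ioi 0) := (h1.add h2).const_mul K
  refine h3.congr_fun (fun u _ => ?_) measurableSet_Ioi
  rw [show lam + 1 / 2 - 1 = lam - 1 / 2 by ring, show lam + 1 - 1 = lam by ring]; ring

/-- `∫₀^∞ c u^λ e^{-u} du = c Γ(λ+1)`. [folklore] -/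
theorem integral_const_mul_rpow_mul_exp_neg {lam : ℝ} (hlam : 0 ≤ lam) (c : ℝ) :
    ∫ u in Ioi (0 : ℝ), c * u ^ lam * Real.exp (-u) = c * Real.Gamma (lam + 1) := by
  rw [Real.Gamma_eq_integral (by linarith : 0 < lam + 1), ← integral_const_mul]
  refine setIntegral_congr_fun measurableSet_Ioi fun u _ => ?_
  rw [add_sub_cancel_right]; ring


/-! ### Step 3: dominated convergence -/

/-- **Abelian theorem for power-log sublevel volumes.** On a finite measure space, for a
measurable `S ≥ 0` with `μ{S ≤ t} ∼ c t^λ (log 1/t)^m` as `t → 0⁺` (`λ ≥ 0`, `m ∈ ℕ`):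
`(∫ e^{-βS} dμ) β^λ / (log β)^m → c Γ(λ+1)` as `β → ∞`. (Leading-order Laplace transform of
`t^λ (log 1/t)^m`: AGV II §7.2.4, formula after Thm. 7.4; Watanabe 2009 Thm. 7.1 (3) ⟹ (1).)
[cite: ArnoldGuseinzadeVarchenko2012, Part II §7.2.4 (formula after Thm. 7.4) and §7.3.3 Corollary of Thm. 7.6] -/
theorem tendsto_laplace_mul_rpow_div_log_pow [IsFiniteMeasure μ] (hS : Measurable S)
    (hS0 : ∀ x, 0 ≤ S x) {c lam : ℝ} {m : ℕ} (hlam : 0 ≤ lam)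
    (hV : Tendsto (fun t : ℝ => (μ {x | S x ≤ t}).toReal / (t ^ lam * Real.log t⁻¹ ^ m))
      (𝓝[>] 0) (𝓝 c)) :
    Tendsto (fun β : ℝ => (∫ x, Real.exp (-(β * S x)) ∂μ) * β ^ lam / Real.log β ^ m)
      atTop (𝓝 (c * Real.Gamma (lam + 1))) := by
  set V : ℝ → ℝ := fun t => (μ {x | S x ≤ t}).toReal with hVdef
  have hVmono : Monotone V := fun u v huv =>
    ENNReal.toReal_mono (measure_ne_top _ _) (measure_mono fun x (hx : S x ≤ u) => hx.trans huv)
  have hV0 : ∀ t, 0 ≤ V t := fun t => ENNReal.toReal_nonneg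
  set M : ℝ := (μ univ).toReal with hMdef
  have hVM : ∀ t, V t ≤ M := fun t =>
    ENNReal.toReal_mono (measure_ne_top _ _) (measure_mono (subset_univ _))
  -- (a) the asymptotic hypothesis as a bound near `0`
  have hev : ∀ᶠ t in 𝓝[>] (0 : ℝ), V t ≤ (|c| + 1) * (t ^ lam * Real.log t⁻¹ ^ m) := by
    have h1 : ∀ᶠ t in 𝓝[>] (0 : ℝ), V t / (t ^ lam * Real.log t⁻¹ ^ m) < |c| + 1 :=
      hV.eventually (gt_mem_nhds (by linarith [le_abs_self c]))
    have h2 : ∀ᶠ t in 𝓝[>] (0 : ℝ), 0 < t ^ lam * Real.log t⁻¹ ^ m := by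
      filter_upwards [Ioo_mem_nhdsGT (show (0 : ℝ) < 1 by norm_num)] with t ht
      exact mul_pos (Real.rpow_pos_of_pos ht.1 _)
        (pow_pos (Real.log_pos ((one_lt_inv₀ ht.1).2 ht.2)) _)
    filter_upwards [h1, h2] with t h1 h2
    exact ((div_lt_iff₀ h2).1 h1).le
  obtain ⟨t₀, ht₀, ht₀1, hVb⟩ : ∃ t₀ : ℝ, 0 < t₀ ∧ t₀ ≤ 1 ∧
      ∀ t, 0 < t → t < t₀ → V t ≤ (|c| + 1) * (t ^ lam * Real.log t⁻¹ ^ m) := by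
    obtain ⟨b, hb, hsub⟩ := mem_nhdsGT_iff_exists_Ioo_subset.1 hev
    exact ⟨min b 1, lt_min hb one_pos, min_le_right _ _, fun t ht htb =>
      hsub ⟨ht, htb.trans_le (min_le_left _ _)⟩⟩
  -- constants of the dominating function
  set A : ℝ := (|c| + 1) * (1 + 2 * m : ℝ) ^ m with hAdef
  have hc1 : 0 ≤ |c| + 1 := by positivity
  have hA1 : |c| + 1 ≤ A := le_mul_of_one_le_right hc1 (one_le_pow₀ (by linarith))
  set K : ℝ := A + M / t₀ ^ lam with hKdef
  have hK1 : A ≤ K :=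
    le_add_of_nonneg_right (div_nonneg ENNReal.toReal_nonneg (Real.rpow_nonneg ht₀.le _))
  have hK2 : M / t₀ ^ lam ≤ K := le_add_of_nonneg_left ((hc1).trans hA1)
  -- the integrands
  set F : ℝ → ℝ → ℝ := fun β u => Real.exp (-u) * V (u / β) * (β ^ lam / Real.log β ^ m)
    with hFdef
  have hZ : ∀ β : ℝ, 0 < β →
      (∫ x, Real.exp (-(β * S x)) ∂μ) * β ^ lam / Real.log β ^ m = ∫ u in Ioi (0 : ℝ), F β u := by
    intro β hβ
    rw [integral_exp_neg_mul_eq hS hS0 hβ, mul_div_assoc, ← integral_mul_const]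
  -- (b) domination for `β ≥ β₀`
  have hdom : ∀ β : ℝ, Real.exp 1 ≤ β → 1 / t₀ ≤ β → ∀ u : ℝ, 0 < u →
      F β u ≤ K * (u ^ (lam - 1 / 2) + u ^ lam) * Real.exp (-u) := by
    intro β hβe hβt u hu
    have hβ1 : 1 ≤ Real.log β := by
      rw [← Real.log_exp 1]; exact Real.log_le_log (Real.exp_pos 1) hβe
    have hβ0 : 0 < β := (Real.exp_pos 1).trans_le hβe
    have hlogβ : 0 < Real.log β := one_pos.trans_le hβ1
    have hlm : 1 ≤ Real.log β ^ m := one_le_pow₀ hβ1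
    have heu : 0 < Real.exp (-u) := Real.exp_pos _
    have hul : 0 ≤ u ^ lam := Real.rpow_nonneg hu.le _
    have hul' : 0 ≤ u ^ (lam - 1 / 2) := Real.rpow_nonneg hu.le _
    have hg1 : K * u ^ lam * Real.exp (-u) ≤ K * (u ^ (lam - 1 / 2) + u ^ lam) * Real.exp (-u) := by
      have : K * u ^ lam ≤ K * (u ^ (lam - 1 / 2) + u ^ lam) := by nlinarith
      exact mul_le_mul_of_nonneg_right this heu.le
    have hg2 : K * u ^ (lam - 1 / 2) * Real.exp (-u) ≤
        K * (u ^ (lam - 1 / 2) + u ^ lam) * Real.exp (-u) := by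
      have : K * u ^ (lam - 1 / 2) ≤ K * (u ^ (lam - 1 / 2) + u ^ lam) := by nlinarith
      exact mul_le_mul_of_nonneg_right this heu.le
    rcases lt_or_ge (u / β) t₀ with h1 | h2
    · -- regime `u/β < t₀`: use the asymptotic bound on `V`
      have huβ : 0 < u / β := div_pos hu hβ0
      have hVu := hVb _ huβ h1
      have hlog : Real.log (u / β)⁻¹ = Real.log β - Real.log u := by
        rw [inv_div, Real.log_div hβ0.ne' hu.ne']
      have hub : u ≤ β := by
        have : u / β ≤ 1 := h1.le.trans ht₀1
        rwa [div_le_one hβ0] at this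
      have hFle : F β u ≤ (|c| + 1) * u ^ lam * ((Real.log β - Real.log u) / Real.log β) ^ m *
          Real.exp (-u) := by
        have hid : (u / β) ^ lam * (β ^ lam / Real.log β ^ m) * Real.log (u / β)⁻¹ ^ m =
            u ^ lam * ((Real.log β - Real.log u) / Real.log β) ^ m := by
          rw [hlog, div_pow, Real.div_rpow hu.le hβ0.le]
          field_simp
        calc F β u = Real.exp (-u) * V (u / β) * (β ^ lam / Real.log β ^ m) := rfl
          _ ≤ Real.exp (-u) * ((|c| + 1) * ((u / β) ^ lam * Real.log (u / β)⁻¹ ^ m)) *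
              (β ^ lam / Real.log β ^ m) := by gcongr
          _ = (|c| + 1) * ((u / β) ^ lam * (β ^ lam / Real.log β ^ m) * Real.log (u / β)⁻¹ ^ m) *
              Real.exp (-u) := by ring
          _ = _ := by rw [hid]; ring
      rcases le_or_gt u 1 with hu1 | hu1
      · -- `u ≤ 1`
        have hr := div_log_pow_le m hu hu1 hβ1
        calc F β u ≤ (|c| + 1) * u ^ lam * ((Real.log β - Real.log u) / Real.log β) ^ m *
              Real.exp (-u) := hFle
          _ ≤ (|c| + 1) * u ^ lam * ((1 + 2 * m : ℝ) ^ m * u ^ (-(1 / 2 : ℝ))) *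
              Real.exp (-u) := by gcongr
          _ = A * (u ^ lam * u ^ (-(1 / 2 : ℝ))) * Real.exp (-u) := by rw [hAdef]; ring
          _ = A * u ^ (lam - 1 / 2) * Real.exp (-u) := by
              rw [← Real.rpow_add hu, ← sub_eq_add_neg]
          _ ≤ K * u ^ (lam - 1 / 2) * Real.exp (-u) := by gcongr
          _ ≤ _ := hg2
      · -- `1 < u ≤ β`
        have hr := div_log_pow_le_one m hu1.le (Real.log_le_log hu hub) hlogβ
        calc F β u ≤ (|c| + 1) * u ^ lam * ((Real.log β - Real.log u) / Real.log β) ^ m *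
              Real.exp (-u) := hFle
          _ ≤ (|c| + 1) * u ^ lam * 1 * Real.exp (-u) := by gcongr
          _ ≤ K * u ^ lam * Real.exp (-u) := by
              rw [mul_one]; gcongr; exact hA1.trans hK1
          _ ≤ _ := hg1
    · -- regime `u/β ≥ t₀`: `V ≤ M`, `β ≤ u/t₀`
      have hβu : β ≤ u / t₀ := by
        rw [le_div_iff₀ ht₀]; have := (le_div_iff₀ hβ0).1 h2; linarith
      have h3 : β ^ lam ≤ u ^ lam / t₀ ^ lam := by
        rw [← Real.div_rpow hu.le ht₀.le]
        exact Real.rpow_le_rpow hβ0.le hβu hlam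
      calc F β u = Real.exp (-u) * V (u / β) * (β ^ lam / Real.log β ^ m) := rfl
        _ ≤ Real.exp (-u) * M * (β ^ lam / 1) := by
            gcongr
            · exact hVM _
        _ ≤ Real.exp (-u) * M * (u ^ lam / t₀ ^ lam) := by rw [div_one]; gcongr
        _ = M / t₀ ^ lam * u ^ lam * Real.exp (-u) := by ring
        _ ≤ K * u ^ lam * Real.exp (-u) := by gcongr
        _ ≤ _ := hg1
  -- (c) pointwise limit
  have hlim : ∀ u : ℝ, 0 < u →
      Tendsto (fun β => F β u) atTop (𝓝 (c * u ^ lam * Real.exp (-u))) := by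
    intro u hu
    -- `u/β → 0⁺`
    have h1 : Tendsto (fun β : ℝ => u / β) atTop (𝓝[>] 0) := by
      refine tendsto_nhdsWithin_of_tendsto_nhds_of_eventually_within _
        (tendsto_const_nhds.div_atTop tendsto_id) ?_
      filter_upwards [eventually_gt_atTop 0] with β hβ using div_pos hu hβ
    have hQ := hV.comp h1
    -- `(log β - log u)/log β → 1`
    have h2 : Tendsto (fun β : ℝ => ((Real.log β - Real.log u) / Real.log β) ^ m) atTop
        (𝓝 1) := by
      have h3 : Tendsto (fun β : ℝ => 1 - Real.log u / Real.log β) atTop (𝓝 (1 - 0)) :=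
        tendsto_const_nhds.sub (tendsto_const_nhds.div_atTop Real.tendsto_log_atTop)
      rw [sub_zero] at h3
      have h4 := h3.pow m
      rw [one_pow] at h4
      refine h4.congr' ?_
      filter_upwards [eventually_gt_atTop 1] with β hβ
      have : Real.log β ≠ 0 := (Real.log_pos hβ).ne'
      field_simp
    have h5 := (hQ.mul h2).const_mul (Real.exp (-u) * u ^ lam)
    rw [mul_one, show Real.exp (-u) * u ^ lam * c = c * u ^ lam * Real.exp (-u) by ring] at h5
    refine h5.congr' ?_
    filter_upwards [eventually_gt_atTop u, eventually_gt_atTop 1] with β hβu hβ1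
    have hβ0 : 0 < β := one_pos.trans hβ1
    have huβ : 0 < u / β := div_pos hu hβ0
    have hlog : Real.log (u / β)⁻¹ = Real.log β - Real.log u := by
      rw [inv_div, Real.log_div hβ0.ne' hu.ne']
    have hlogpos : 0 < Real.log β - Real.log u := sub_pos.2 (Real.log_lt_log hu hβu)
    have hlogβ : Real.log β ≠ 0 := (Real.log_pos hβ1).ne'
    have hβlam : β ^ lam ≠ 0 := (Real.rpow_pos_of_pos hβ0 _).ne'
    have hulam : u ^ lam ≠ 0 := (Real.rpow_pos_of_pos hu _).ne'
    show Real.exp (-u) * u ^ lam * (V (u / β) / ((u / β) ^ lam * Real.log (u / β)⁻¹ ^ m) *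
        ((Real.log β - Real.log u) / Real.log β) ^ m) =
      Real.exp (-u) * V (u / β) * (β ^ lam / Real.log β ^ m)
    rw [hlog, Real.div_rpow hu.le hβ0.le]
    generalize V (u / β) = v
    rw [div_pow]
    field_simp
  -- (d) dominated convergence on `(0, ∞)`
  have hmain : Tendsto (fun β => ∫ u in Ioi (0 : ℝ), F β u) atTop
      (𝓝 (∫ u in Ioi (0 : ℝ), c * u ^ lam * Real.exp (-u))) := by
    refine tendsto_integral_filter_of_dominated_convergence
      (fun u => K * (u ^ (lam - 1 / 2) + u ^ lam) * Real.exp (-u)) ?_ ?_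
      (integrableOn_bound hlam K) ?_
    · refine Eventually.of_forall fun β => ?_
      have hm' : Measurable fun u : ℝ => F β u :=
        (measurable_id.neg.exp.mul (hVmono.measurable.comp (measurable_id.div_const β))).mul
          measurable_const
      exact hm'.aestronglyMeasurable
    · filter_upwards [eventually_ge_atTop (Real.exp 1), eventually_ge_atTop (1 / t₀)] with β hβe hβt
      refine ae_restrict_of_forall_mem measurableSet_Ioi fun u hu => ?_
      have hu : 0 < u := hu
      have hβ0 : 0 < β := (Real.exp_pos 1).trans_le hβe
      have hF0 : 0 ≤ F β u := by
        have : 0 ≤ β ^ lam / Real.log β ^ m :=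
          div_nonneg (Real.rpow_nonneg hβ0.le _)
            (pow_nonneg (Real.log_nonneg
              ((by linarith [Real.add_one_le_exp (1 : ℝ)] : (1 : ℝ) ≤ Real.exp 1).trans hβe)) _)
        exact mul_nonneg (mul_nonneg (Real.exp_pos _).le (hV0 _)) this
      rw [Real.norm_eq_abs, abs_of_nonneg hF0]
      exact hdom β hβe hβt u hu
    · exact ae_restrict_of_forall_mem measurableSet_Ioi fun u hu => hlim u hu
  rw [integral_const_mul_rpow_mul_exp_neg hlam c] at hmain
  refine hmain.congr' ?_
  filter_upwards [eventually_gt_atTop 0] with β hβ using (hZ β hβ).symm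

end LaplacePowerLog

end Literature.Analysis.Asymptotics

end
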